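import Literature.NumberTheory.EllipticCurves.HeegnerPointsKolyvaginVisibleDescentProofs
import Literature.NumberTheory.EllipticCurves.HeegnerPointsKolyvaginSplitDescentPairProofs
import HarnessLib

/-!
# Kolyvagin's descent modulo `p^M` for a PAIR with VISIBLE Čebotarev: the data on `V₁ × V₂`
# (Kolyvagin's frame `(E, E^D)` over `ℚ` at `l = 2`), any prime `p`

Sibling of `HeegnerPointsKolyvaginSplitDescentPairProofs` (`KolyvaginDescent.PairHypothesesM`:
the split data CONSTRUCTED on a product `V₁ × V₂`, parts `V₁ × 0`, `0 × V₂`, Kolyvagin's class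
placed by the parity of its depth) for the VISIBLE form of the Čebotarev axiom
(`KolyvaginDescent.VisibleSplitHypothesesM`, sibling `HeegnerPointsKolyvaginVisibleDescentProofs`).
The product-form axiom `PairHypothesesM.cebotarev` — Cor. 3.2 for every pure independent family
in `V₁ × V₂` — is NOT instantiable at `p = 2` with `V₁ = H¹(ℚ, E^{ε}[2^M])`,
`V₂ = H¹(ℚ, E^{-ε}[2^M])`: classes of the two members with entangled bottom bits
(`E[2] = E^D[2]`), and the inflated class `ξ_E` (`H¹(Gal(ℚ(E[2^M])/ℚ), E[2]) = 𝔽₂ξ_E`,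
Lawson–Wuthrich), have tied resp. zero localisations at every Kolyvagin prime. Here the pair data
carry the two restriction maps `rK₁ : V₁ →+ H`, `rK₂ : V₂ →+ H` to ONE group `H` (at `2`:
restriction to `K(E[2^M])` of classes of `E^{ε}`, resp. of `E^{-ε}` through `E^D[2^M] ≅ E[2^M]`
over `K`), the common local condition `LocK ℓ ≤ H` through which both members' Selmer conditions
at a Kolyvagin prime factor (`mem_loc₁_pl_iff`, `mem_loc₂_pl_iff`: at `2`, the finite condition at
the inert `λ` for `E/K_λ`, read after restriction — two `K`-classes with the same restriction to
`K(E[2^M])` differ by an inflated class, which dies at `λ`), the visibility of the pair Selmer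
group (`sel_visible`: `rK₁ s₁ + rK₂ s₂ = 0 ⟹ s₁ = s₂ = 0`; at `2`:
**`Sel₂(E^{ε}/ℚ) ⊕ Sel₂(E^{-ε}/ℚ) ⊕ 𝔽₂ξ_E` direct in `H¹(ℚ, E[2])`** — the habitat condition (H2)
of the BSD route `GenusKolyvaginAtTwo`, LINE 6), and Cor. 3.2 for pure families independent after
`(u, w) ↦ rK₁ u + rK₂ w` — at `2` exactly the tree's signed Čebotarev
`GenusExact.equivariantChebotarevAtTwo_signed_of_not_isSquare` (π = id) read over `ℚ_ℓ`, whose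
binders (`K`-independence, `hres`) ARE independence after restriction to `K(E[2^M])`.

* `KolyvaginDescent.VisiblePairHypothesesM V₁ V₂ Pl H` — the data;
* `VisiblePairHypothesesM.toVisibleSplit : VisibleSplitHypothesesM (V₁ × V₂) Pl H` — the
  construction (`rK = rK₁ ∘ pr₁ + rK₂ ∘ pr₂`);
* the conclusions in pair language, any prime `p`, VISIBLE pairs:
  `pow_zsmul_sel₂_eq_zero_and_sel₁_le` (**`p^{M₀} · Sel₂ = 0`**, Claim A — at `2` the exponent
  form of Kolyvagin's Thm. `B_2` for the rank-`0` member — and **`p^{2M₀} · Sel₁ ⊆ ℤ x`**, Claim B),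
  `sel₂_eq_bot_and_sel₁_eq_of_M₀_eq_zero` (exact case `M₀ = 0`), `exists_mem_sel₂_addOrderOf_eq`
  (lower-bound element of exact order: `M₀ − M₁ ≤ N₁`).

Pure algebra; no named fact; the instantiation at `2` (classes, Lemma 4.3, Prop. 4.4 = crux Q2,
Lemma 5.3 over `ℚ_ℓ`, the factorisation at `λ`, (H2), the signed Čebotarev) is the business of the
BSD route `GenusKolyvaginAtTwo` (crux Q3′, seat `bsd-line-gk2-p3`). Nothing here is a claim about
BSD.

## References

* V. A. Kolyvagin, Math. USSR-Izv. 32 (1989) 523–541: Thm. `B_l` (l = 2), §3. [Kolyvagin1989Izv]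
* W. G. McCallum, *Kolyvagin's work on Shafarevich–Tate groups*, LMS LNS 153 (1991): p. 299,
  Cor. 3.2, Lemma 4.3, Prop. 4.4, Lemma 5.3, §5. [McCallumLMS1991]
* B. H. Gross, *Kolyvagin's work on modular elliptic curves*, same volume: Prop. 5.4 (2),
  Prop. 9.1, §10. [GrossLMS1991]
* T. Lawson, C. Wuthrich, *Vanishing of some Galois cohomology groups for elliptic curves*,
  Springer PROMS 188 (2016), §7.1, §8 (arXiv:1505.02940). [LawsonWuthrich2016]
-/

noncomputable section

open scoped Classical

namespace Literature.NumberTheory.EllipticCurves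

namespace KolyvaginDescent

/-! ## The visible pair data -/

/-- **Kolyvagin's descent modulo `p^M` for a pair, VISIBLE Čebotarev, the data** (any prime `p`).
As `KolyvaginDescent.PairHypothesesM` (two groups `V₁`, `V₂` killed by `p^M` — at `2`:
`H¹(ℚ, E^{ε}[2^M])`, `H¹(ℚ, E^{-ε}[2^M])` —, Selmer groups cut out by local conditions, Kolyvagin
primes, strict conditions, `x ∈ Sel₁` of order `p^M`, `M₀`, classes `c₁` (even depth) / `c₂` (odd
depth) with Lemma 4.3 on each side, Prop. 4.4 across, Lemma 5.3 + Prop. 2.2 on each side) with the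
Čebotarev axiom in VISIBLE form: restriction maps `rK₁`, `rK₂` to one group `H` (McCallum p. 299:
*"the restriction map `H¹(K, E_{p^M}) → H¹(K(E_{p^M}), E_{p^M})`"*), the common local condition
`LocK ℓ` at Kolyvagin primes through which `Loc₁ (pl ℓ)`, `Loc₂ (pl ℓ)` factor, visibility of
`Sel₁ × Sel₂` (Gross 1991 Prop. 9.1 at `p` odd; at `2`: `Sel₂(E^{ε}) ⊕ Sel₂(E^{-ε}) ⊕ 𝔽₂ξ_E`
direct), and Cor. 3.2 (*"there exist infinitely many primes `ℓ ∈ S₁(M)` such that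
`ord c_{i,λ} = p^{N_i}`"*) for pure families independent after `rK₁ + rK₂`.
[cite: Kolyvagin1989Izv, §3 (Thm. B_l, l = 2: the pair (E, E^D) over ℚ)]
[cite: McCallumLMS1991, §3 (p. 299, Cor. 3.2), §§4–5 (Lemma 4.3, Prop. 4.4, Lemma 5.3)]
[cite: GrossLMS1991, Prop. 9.1 and §10] -/
structure VisiblePairHypothesesM (V₁ V₂ : Type*) [AddCommGroup V₁] [AddCommGroup V₂] (Pl : Type*)
    (H : Type*) [AddCommGroup H] where
  /-- The prime `p` (any prime). -/
  p : ℕ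
  /-- `p` is prime. -/
  hp : p.Prime
  /-- The level `M`. -/
  M : ℕ
  /-- `V₁` is killed by `p^M`. -/
  torsion₁ : ∀ v : V₁, ((p : ℤ) ^ M) • v = 0
  /-- `V₂` is killed by `p^M`. -/
  torsion₂ : ∀ v : V₂, ((p : ℤ) ^ M) • v = 0
  /-- The Selmer group of the first member. -/
  Sel₁ : AddSubgroup V₁
  /-- The Selmer group of the second member. -/
  Sel₂ : AddSubgroup V₂
  /-- Local conditions of the first member. -/
  Loc₁ : Pl → AddSubgroup V₁
  /-- Local conditions of the second member. -/
  Loc₂ : Pl → AddSubgroup V₂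
  /-- `Sel₁` is cut out by its local conditions. -/
  mem_sel_iff₁ : ∀ s, s ∈ Sel₁ ↔ ∀ v, s ∈ Loc₁ v
  /-- `Sel₂` is cut out by its local conditions. -/
  mem_sel_iff₂ : ∀ s, s ∈ Sel₂ ↔ ∀ v, s ∈ Loc₂ v
  /-- Kolyvagin primes. -/
  Kol : ℕ → Prop
  /-- Kolyvagin primes are primes. -/
  prime_of_kol : ∀ ℓ, Kol ℓ → ℓ.Prime
  /-- The place of a Kolyvagin prime. -/
  pl : ℕ → Pl
  /-- "`v` divides `n`". -/
  Dv : Pl → ℕ → Prop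
  /-- `pl ℓ` is the unique place dividing `ℓ`. -/
  dv_iff : ∀ ℓ, Kol ℓ → ∀ v, Dv v ℓ ↔ v = pl ℓ
  /-- A place dividing `ℓ ℓ'` divides `ℓ` or `ℓ'`. -/
  dv_mul : ∀ ℓ ℓ', Kol ℓ → Kol ℓ' → ∀ v, Dv v (ℓ * ℓ') → Dv v ℓ ∨ Dv v ℓ'
  /-- Strict local conditions of the first member at Kolyvagin primes. -/
  A₁ : ℕ → AddSubgroup V₁
  /-- Strict local conditions of the second member at Kolyvagin primes. -/
  A₂ : ℕ → AddSubgroup V₂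
  /-- `x = δ_M x₀` on the first member. -/
  x : V₁
  /-- `x ∈ Sel₁`. -/
  x_mem : x ∈ Sel₁
  /-- `x` has order `p^M`. -/
  x_ord : ((p : ℤ) ^ (M - 1)) • x ≠ 0
  /-- `M₀`. -/
  M₀ : ℕ
  /-- Kolyvagin's classes of even depth (first member). -/
  c₁ : ℕ → V₁
  /-- Kolyvagin's classes of odd depth (second member). -/
  c₂ : ℕ → V₂
  /-- `c_M(1) = p^{M₀} x`. -/
  c_one : c₁ 1 = ((p : ℤ) ^ M₀) • x
  /-- **Lemma 4.3**, even depth. -/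
  c_mem_loc₁ : ∀ n, KolSupp Kol n → Even n.primeFactors.card → ∀ v, ¬ Dv v n → c₁ n ∈ Loc₁ v
  /-- **Lemma 4.3**, odd depth. -/
  c_mem_loc₂ : ∀ n, KolSupp Kol n → Odd n.primeFactors.card → ∀ v, ¬ Dv v n → c₂ n ∈ Loc₂ v
  /-- **Prop. 4.4** from even depth `m` to odd depth `ℓm`. -/
  c_mem_loc_iff₁₂ : ∀ ℓ m, Kol ℓ → KolSupp Kol (ℓ * m) → Even m.primeFactors.card → ∀ a : ℕ,
    (((p : ℤ) ^ a) • c₂ (ℓ * m) ∈ Loc₂ (pl ℓ)) ↔ ((p : ℤ) ^ a) • c₁ m ∈ A₁ ℓ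
  /-- **Prop. 4.4** from odd depth `m` to even depth `ℓm`. -/
  c_mem_loc_iff₂₁ : ∀ ℓ m, Kol ℓ → KolSupp Kol (ℓ * m) → Odd m.primeFactors.card → ∀ a : ℕ,
    (((p : ℤ) ^ a) • c₁ (ℓ * m) ∈ Loc₁ (pl ℓ)) ↔ ((p : ℤ) ^ a) • c₂ m ∈ A₂ ℓ
  /-- **Lemma 5.3 with Prop. 2.2**, first member. -/
  duality₁ : ∀ ℓ, Kol ℓ → ∀ d : V₁, (∀ v, v ≠ pl ℓ → d ∈ Loc₁ v) → ∀ s ∈ Sel₁,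
    ∀ a, a < M → ((p : ℤ) ^ a) • d ∉ Loc₁ (pl ℓ) → ((p : ℤ) ^ (M - 1 - a)) • s ∈ A₁ ℓ
  /-- **Lemma 5.3 with Prop. 2.2**, second member. -/
  duality₂ : ∀ ℓ, Kol ℓ → ∀ d : V₂, (∀ v, v ≠ pl ℓ → d ∈ Loc₂ v) → ∀ s ∈ Sel₂,
    ∀ a, a < M → ((p : ℤ) ^ a) • d ∉ Loc₂ (pl ℓ) → ((p : ℤ) ^ (M - 1 - a)) • s ∈ A₂ ℓ
  /-- Restriction of the first member's classes to `K(E_{p^M})` (abstract). -/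
  rK₁ : V₁ →+ H
  /-- Restriction of the second member's classes to `K(E_{p^M})` (abstract; at `2` through
  `E^D[2^M] ≅ E[2^M]` over `K`). -/
  rK₂ : V₂ →+ H
  /-- The common local condition at the Kolyvagin prime `ℓ`, read in `H`. -/
  LocK : ℕ → AddSubgroup H
  /-- At a Kolyvagin prime the first member's local condition factors through `rK₁`. -/
  mem_loc₁_pl_iff : ∀ ℓ, Kol ℓ → ∀ u : V₁, u ∈ Loc₁ (pl ℓ) ↔ rK₁ u ∈ LocK ℓ
  /-- At a Kolyvagin prime the second member's local condition factors through `rK₂`. -/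
  mem_loc₂_pl_iff : ∀ ℓ, Kol ℓ → ∀ w : V₂, w ∈ Loc₂ (pl ℓ) ↔ rK₂ w ∈ LocK ℓ
  /-- **The pair Selmer group is visible** (at `2`: `Sel₂(E^{ε}) ⊕ Sel₂(E^{-ε}) ⊕ 𝔽₂ξ_E` is a
  direct sum in `H¹(ℚ, E[2])`). -/
  sel_visible : ∀ s₁ ∈ Sel₁, ∀ s₂ ∈ Sel₂, rK₁ s₁ + rK₂ s₂ = 0 → s₁ = 0 ∧ s₂ = 0
  /-- **Cor. 3.2, visible form** for pure families in `V₁ × V₂` (each member in a factor)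
  independent after `rK₁ + rK₂`. -/
  cebotarev : ∀ (r : ℕ) (cs : Fin r → V₁ × V₂) (Nv : Fin r → ℕ), (∀ i, cs i ≠ 0) →
    (∀ i, Nv i ≠ 0 → ((p : ℤ) ^ (Nv i - 1)) • cs i ≠ 0) →
    (∀ i, (cs i).2 = 0 ∨ (cs i).1 = 0) →
    (∀ a : Fin r → ℤ, ∑ i, a i • (rK₁ (cs i).1 + rK₂ (cs i).2) = 0 → ∀ i, a i • cs i = 0) →
    ∀ b : ℕ, ∃ ℓ, b < ℓ ∧ Kol ℓ ∧ ∀ i, ((p : ℤ) ^ Nv i) • cs i ∈ (A₁ ℓ).prod (A₂ ℓ) ∧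
      (Nv i ≠ 0 → ((p : ℤ) ^ (Nv i - 1)) • cs i ∉ (A₁ ℓ).prod (A₂ ℓ))

namespace VisiblePairHypothesesM

variable {V₁ V₂ : Type*} [AddCommGroup V₁] [AddCommGroup V₂] {Pl : Type*} {H : Type*}
variable [AddCommGroup H] (S : VisiblePairHypothesesM V₁ V₂ Pl H)

/-! ### Parity bookkeeping and the two parts (plumbing) -/

/-- For `ℓm` a square-free product of Kolyvagin primes with `ℓ` one of them: `m` is such a product
and `r(ℓm) = r(m) + 1`. [cite: GrossLMS1991, §3 (3.1)–(3.2)] -/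
private theorem kolSupp_of_mul {ℓ m : ℕ} (hℓ : S.Kol ℓ) (hn : KolSupp S.Kol (ℓ * m)) :
    KolSupp S.Kol m ∧ m.primeFactors.card + 1 = (ℓ * m).primeFactors.card := by
  have hℓp := S.prime_of_kol ℓ hℓ
  have hmem : ℓ ∈ (ℓ * m).primeFactors :=
    Nat.mem_primeFactors.mpr ⟨hℓp, dvd_mul_right ℓ m, hn.ne_zero⟩
  obtain ⟨hsupp, -, -, -, -, -, -, hcard⟩ := kolSupp_div hn hmem
  rw [Nat.mul_div_cancel_left m hℓp.pos] at hsupp hcard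
  exact ⟨hsupp, hcard⟩

/-- `v ∈ V^{(1)} ↔ v.2 = 0`. [folklore] -/
private theorem mem_pairEig_one {v : V₁ × V₂} : v ∈ pairEig V₁ V₂ 1 ↔ v.2 = 0 := by
  simp [pairEig, AddSubgroup.mem_prod]

/-- `v ∈ V^{(-1)} ↔ v.1 = 0`. [folklore] -/
private theorem mem_pairEig_neg_one {v : V₁ × V₂} : v ∈ pairEig V₁ V₂ (-1) ↔ v.1 = 0 := by
  simp [pairEig, AddSubgroup.mem_prod]

/-- The class at even depth is `(c₁ n, 0)`. [folklore] -/
private theorem pairClass_of_even {n : ℕ} (h : Even n.primeFactors.card) :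
    pairClass S.c₁ S.c₂ n = (S.c₁ n, 0) := by
  simp [pairClass, h]

/-- The class at odd depth is `(0, c₂ n)`. [folklore] -/
private theorem pairClass_of_odd {n : ℕ} (h : Odd n.primeFactors.card) :
    pairClass S.c₁ S.c₂ n = (0, S.c₂ n) := by
  have h' : ¬ Even n.primeFactors.card := Nat.not_even_iff_odd.mpr h
  simp [pairClass, h']

/-! ### The visible split data of a visible pair -/

/-- **The visible pair data ARE visible split data** on `V = V₁ × V₂` with parts `V₁ × 0`,
`0 × V₂` (`pairEig`), `Sel = Sel₁ × Sel₂`, `Loc v = Loc₁ v × Loc₂ v`, `A ℓ = A₁ ℓ × A₂ ℓ`,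
`ε = 1`, `x = (x, 0)`, `c = pairClass c₁ c₂`, `rK (u, w) = rK₁ u + rK₂ w`: disjointness of the
parts, the splitting and the visibility of `Sel`, the tags of `x` and `c(n)` and the factorisation
at Kolyvagin primes hold BY CONSTRUCTION, the rest are the pair's fields read through the parity of
the depth. At `p = 2`: Kolyvagin's frame (Izv. 1989, §3) for a VISIBLE pair `(E, E^D)` over `ℚ`.
[cite: Kolyvagin1989Izv, §3] [cite: McCallumLMS1991, §3 (p. 299), §5] [cite: GrossLMS1991, Prop. 5.4 (2), Prop. 9.1] -/
def toVisibleSplit : VisibleSplitHypothesesM (V₁ × V₂) Pl H where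
  p := S.p
  hp := S.hp
  M := S.M
  torsion v := Prod.ext (S.torsion₁ v.1) (S.torsion₂ v.2)
  part := pairEig V₁ V₂
  part_disjoint v h₁ h₂ := Prod.ext (mem_pairEig_neg_one.mp h₂) (mem_pairEig_one.mp h₁)
  Sel := S.Sel₁.prod S.Sel₂
  sel_split s hs := by
    rw [AddSubgroup.mem_prod] at hs
    refine ⟨(s.1, 0), (0, s.2), ⟨?_, mem_pairEig_one.mpr rfl⟩, ⟨?_, mem_pairEig_neg_one.mpr rfl⟩,
      Prod.ext (by simp) (by simp)⟩
    · exact AddSubgroup.mem_prod.mpr ⟨hs.1, S.Sel₂.zero_mem⟩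
    · exact AddSubgroup.mem_prod.mpr ⟨S.Sel₁.zero_mem, hs.2⟩
  Loc v := (S.Loc₁ v).prod (S.Loc₂ v)
  mem_sel_iff s := by
    simp only [AddSubgroup.mem_prod, S.mem_sel_iff₁, S.mem_sel_iff₂]
    exact ⟨fun h v ↦ ⟨h.1 v, h.2 v⟩, fun h ↦ ⟨fun v ↦ (h v).1, fun v ↦ (h v).2⟩⟩
  Kol := S.Kol
  prime_of_kol := S.prime_of_kol
  pl := S.pl
  Dv := S.Dv
  dv_iff := S.dv_iff
  dv_mul := S.dv_mul
  A ℓ := (S.A₁ ℓ).prod (S.A₂ ℓ)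
  x := (S.x, 0)
  x_mem := AddSubgroup.mem_prod.mpr ⟨S.x_mem, S.Sel₂.zero_mem⟩
  x_ord h := S.x_ord (by simpa using congrArg Prod.fst h)
  M₀ := S.M₀
  ε := 1
  hε := Or.inl rfl
  x_part := mem_pairEig_one.mpr rfl
  c := pairClass S.c₁ S.c₂
  c_one := by
    have h0 : Even (1 : ℕ).primeFactors.card := by simp
    rw [S.pairClass_of_even h0, S.c_one]
    exact Prod.ext (by simp) (by simp)
  c_part n _ := by
    rcases Nat.even_or_odd n.primeFactors.card with h | h
    · rw [S.pairClass_of_even h, h.neg_one_pow, one_mul]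
      exact mem_pairEig_one.mpr rfl
    · rw [S.pairClass_of_odd h, h.neg_one_pow, mul_neg_one]
      exact mem_pairEig_neg_one.mpr rfl
  c_mem_loc n hn v hv := by
    rcases Nat.even_or_odd n.primeFactors.card with h | h
    · rw [S.pairClass_of_even h]
      exact AddSubgroup.mem_prod.mpr ⟨S.c_mem_loc₁ n hn h v hv, (S.Loc₂ v).zero_mem⟩
    · rw [S.pairClass_of_odd h]
      exact AddSubgroup.mem_prod.mpr ⟨(S.Loc₁ v).zero_mem, S.c_mem_loc₂ n hn h v hv⟩
  c_mem_loc_iff ℓ m hℓ hn a := by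
    obtain ⟨-, hcard⟩ := S.kolSupp_of_mul hℓ hn
    rcases Nat.even_or_odd m.primeFactors.card with h | h
    · have h' : Odd (ℓ * m).primeFactors.card := by rw [← hcard]; exact h.add_one
      rw [S.pairClass_of_even h, S.pairClass_of_odd h']
      simp only [Prod.smul_mk, smul_zero, AddSubgroup.mem_prod, AddSubgroup.zero_mem, true_and,
        and_true]
      exact S.c_mem_loc_iff₁₂ ℓ m hℓ hn h a
    · have h' : Even (ℓ * m).primeFactors.card := by rw [← hcard]; exact h.add_one
      rw [S.pairClass_of_odd h, S.pairClass_of_even h']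
      simp only [Prod.smul_mk, smul_zero, AddSubgroup.mem_prod, AddSubgroup.zero_mem, true_and,
        and_true]
      exact S.c_mem_loc_iff₂₁ ℓ m hℓ hn h a
  duality ℓ hℓ ν hν d hd hoff s hs hse a ha hat := by
    rw [AddSubgroup.mem_prod] at hs
    rcases hν with rfl | rfl
    · have hd2 : d.2 = 0 := mem_pairEig_one.mp hd
      have hs2 : s.2 = 0 := mem_pairEig_one.mp hse
      have hoff₁ : ∀ v, v ≠ S.pl ℓ → d.1 ∈ S.Loc₁ v := fun v hv ↦
        (AddSubgroup.mem_prod.mp (hoff v hv)).1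
      have hat₁ : ((S.p : ℤ) ^ a) • d.1 ∉ S.Loc₁ (S.pl ℓ) := fun h ↦
        hat (AddSubgroup.mem_prod.mpr ⟨h, by rw [Prod.smul_snd, hd2, smul_zero]; exact zero_mem _⟩)
      refine AddSubgroup.mem_prod.mpr ⟨S.duality₁ ℓ hℓ d.1 hoff₁ s.1 hs.1 a ha hat₁, ?_⟩
      rw [Prod.smul_snd, hs2, smul_zero]
      exact zero_mem _
    · have hd1 : d.1 = 0 := mem_pairEig_neg_one.mp hd
      have hs1 : s.1 = 0 := mem_pairEig_neg_one.mp hse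
      have hoff₂ : ∀ v, v ≠ S.pl ℓ → d.2 ∈ S.Loc₂ v := fun v hv ↦
        (AddSubgroup.mem_prod.mp (hoff v hv)).2
      have hat₂ : ((S.p : ℤ) ^ a) • d.2 ∉ S.Loc₂ (S.pl ℓ) := fun h ↦
        hat (AddSubgroup.mem_prod.mpr ⟨by rw [Prod.smul_fst, hd1, smul_zero]; exact zero_mem _, h⟩)
      refine AddSubgroup.mem_prod.mpr ⟨?_, S.duality₂ ℓ hℓ d.2 hoff₂ s.2 hs.2 a ha hat₂⟩
      rw [Prod.smul_fst, hs1, smul_zero]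
      exact zero_mem _
  rK := S.rK₁.coprod S.rK₂
  LocK := S.LocK
  mem_loc_pl_iff ℓ hℓ u hu := by
    rw [AddSubgroup.mem_prod, AddMonoidHom.coprod_apply]
    rcases hu with hu | hu
    · have hu2 : u.2 = 0 := mem_pairEig_one.mp hu
      rw [hu2, map_zero, add_zero, ← S.mem_loc₁_pl_iff ℓ hℓ]
      exact ⟨fun h ↦ h.1, fun h ↦ ⟨h, zero_mem _⟩⟩
    · have hu1 : u.1 = 0 := mem_pairEig_neg_one.mp hu
      rw [hu1, map_zero, zero_add, ← S.mem_loc₂_pl_iff ℓ hℓ]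
      exact ⟨fun h ↦ h.2, fun h ↦ ⟨zero_mem _, h⟩⟩
  sel_visible s hs h := by
    rw [AddSubgroup.mem_prod] at hs
    rw [AddMonoidHom.coprod_apply] at h
    obtain ⟨h1, h2⟩ := S.sel_visible s.1 hs.1 s.2 hs.2 h
    exact Prod.ext h1 h2
  cebotarev r cs Nv hne hN heig hind b := by
    refine S.cebotarev r cs Nv hne hN (fun i ↦ ?_) (fun a ha ↦ hind a ?_) b
    · obtain ⟨e, he, hmem⟩ := heig i
      rcases he with rfl | rfl
      · exact Or.inl (mem_pairEig_one.mp hmem)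
      · exact Or.inr (mem_pairEig_neg_one.mp hmem)
    · simpa only [AddMonoidHom.coprod_apply] using ha

/-! ### The conclusions in pair language -/

/-- `toVisibleSplit.p = p`. [folklore] -/
private theorem toVisibleSplit_p : S.toVisibleSplit.p = S.p := rfl

/-- `toVisibleSplit.M₀ = M₀`. [folklore] -/
private theorem toVisibleSplit_M₀ : S.toVisibleSplit.M₀ = S.M₀ := rfl

/-- `toVisibleSplit.x = (x, 0)`. [folklore] -/
private theorem toVisibleSplit_x : S.toVisibleSplit.x = (S.x, 0) := rfl

/-- `toVisibleSplit.M = M`. [folklore] -/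
private theorem toVisibleSplit_M : S.toVisibleSplit.M = S.M := rfl

/-- **Claims A and B for a visible pair, any prime `p`: `p^{M₀} · Sel₂ = 0` and
`p^{2M₀} · Sel₁ ⊆ ℤ x`.** The member WITHOUT the Heegner class is killed by `p^{M₀}` (at `p = 2`,
`V₂ = H¹(ℚ, A[2^M])` for the member `A` of analytic rank `0`: `2^{M₀} Sel_{2^M}(A/ℚ) = 0`, the
exponent form of Kolyvagin's Thm. `B_2` with `C_D = 2^{M₀}` on visible pairs), and on the member
carrying the Heegner class `p^{2M₀} Sel₁ ⊆ ℤ x ⊆ δ_M(E^{ε}(ℚ))`.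
[cite: Kolyvagin1989Izv, Thm. B_l (l = 2), §3] [cite: GrossLMS1991, §10 Claims 10.1, 10.3]
[cite: McCallumLMS1991, §1 Theorem (Kolyvagin)] -/
theorem pow_zsmul_sel₂_eq_zero_and_sel₁_le :
    (∀ s ∈ S.Sel₂, ((S.p : ℤ) ^ S.M₀) • s = 0) ∧
      ∀ s ∈ S.Sel₁, ∃ a : ℤ, ((S.p : ℤ) ^ (2 * S.M₀)) • s = a • S.x := by
  refine ⟨fun s hs ↦ ?_, fun s hs ↦ ?_⟩
  · have h := S.toVisibleSplit.claimA (s := ((0 : V₁), s))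
      (AddSubgroup.mem_prod.mpr ⟨S.Sel₁.zero_mem, hs⟩) (mem_pairEig_neg_one.mpr rfl)
    simpa [toVisibleSplit_p, toVisibleSplit_M₀] using congrArg Prod.snd h
  · obtain ⟨a, ha⟩ := S.toVisibleSplit.claimB (s := (s, (0 : V₂)))
      (AddSubgroup.mem_prod.mpr ⟨hs, S.Sel₂.zero_mem⟩) (mem_pairEig_one.mpr rfl)
    exact ⟨a, by
      simpa [toVisibleSplit_p, toVisibleSplit_M₀, toVisibleSplit_x] using congrArg Prod.fst ha⟩

/-- **`M₀ = 0` for a visible pair: `Sel₂ = 0` and `Sel₁ = ℤ x`** (at `2`: `Sel_{2^M}(A/ℚ) = 0` and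
`Sel_{2^M}(E^{ε}/ℚ) = ℤ/2^M · x` for all `M` — `Ш[2^∞] = 0` for both `ℚ`-members, `rank E^{ε}(ℚ) = 1`,
`rank A(ℚ) = 0` — when `y_K` is `2`-primitive and the pair is visible).
[cite: Kolyvagin1989Izv, Thm. B_l (l = 2)] [cite: GrossLMS1991, Prop. 2.3 (§10)] -/
theorem sel₂_eq_bot_and_sel₁_eq_of_M₀_eq_zero (h0 : S.M₀ = 0) :
    S.Sel₂ = ⊥ ∧ S.Sel₁ = AddSubgroup.zmultiples S.x := by
  obtain ⟨hA, hB⟩ := S.pow_zsmul_sel₂_eq_zero_and_sel₁_le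
  refine ⟨?_, le_antisymm (fun s hs ↦ ?_) (AddSubgroup.zmultiples_le_of_mem S.x_mem)⟩
  · rw [eq_bot_iff]
    intro s hs
    have := hA s hs
    rw [h0, pow_zero, one_zsmul] at this
    rw [AddSubgroup.mem_bot, this]
  · obtain ⟨a, ha⟩ := hB s hs
    rw [h0, mul_zero, pow_zero, one_zsmul] at ha
    exact ⟨a, ha.symm⟩

/-- `c_{M₀}(ℓ) = p^{M−M₀} c₂(ℓ) ∈ Sel₂` for every Kolyvagin prime of a visible pair (`M₀ ≤ M`).
[cite: McCallumLMS1991, §5 (d_{M_{r-1}}(n) ∈ Ш) and Lemma 4.6] -/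
private theorem pow_zsmul_c₂_mem_sel₂ (hM₀ : S.M₀ ≤ S.M) {ℓ : ℕ} (hℓ : S.Kol ℓ) :
    ((S.p : ℤ) ^ (S.M - S.M₀)) • S.c₂ ℓ ∈ S.Sel₂ := by
  have h := (AddSubgroup.mem_inf.mp (S.toVisibleSplit.pow_zsmul_c_mem_sel_inf_part hM₀ hℓ)).1
  have hodd : Odd ℓ.primeFactors.card := by
    rw [card_primeFactors_prime (S.prime_of_kol ℓ hℓ)]; exact odd_one
  change ((S.p : ℤ) ^ (S.M - S.M₀)) • pairClass S.c₁ S.c₂ ℓ ∈ S.Sel₁.prod S.Sel₂ at h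
  rw [S.pairClass_of_odd hodd, AddSubgroup.mem_prod] at h
  simpa using h.2

/-- **The lower-bound element of a visible pair, exact order** (`M₀ − M₁ ≤ N₁`): a Kolyvagin
prime `ℓ` with `p^{M−m−1} c₂(ℓ) ≠ 0`, `p^{M−m} c₂(ℓ) = 0` (`p^m ∥ P_ℓ`), `m < M₀ ≤ M`, puts an
element of order EXACTLY `p^{M₀−m}` into `Sel₂`; at `2` over `ℚ` a `2`-primitive `P_ℓ` gives an
element of order `2^{M₀}` in `Ш(A/ℚ)[2^M]`. [cite: McCallumLMS1991, §5 Thm. 5.4 (proof, case i = 1)] -/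
theorem exists_mem_sel₂_addOrderOf_eq (hM₀ : S.M₀ ≤ S.M) {m : ℕ} (hm : m < S.M₀) {ℓ : ℕ}
    (hℓ : S.Kol ℓ) (hc : ((S.p : ℤ) ^ (S.M - m - 1)) • S.c₂ ℓ ≠ 0)
    (hc' : ((S.p : ℤ) ^ (S.M - m)) • S.c₂ ℓ = 0) :
    ∃ t ∈ S.Sel₂, addOrderOf t = S.p ^ (S.M₀ - m) := by
  refine ⟨((S.p : ℤ) ^ (S.M - S.M₀)) • S.c₂ ℓ, S.pow_zsmul_c₂_mem_sel₂ hM₀ hℓ,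
    addOrderOf_eq_prime_pow S.hp ?_ ?_⟩
  · rw [smul_smul, ← pow_add, show S.M₀ - m + (S.M - S.M₀) = S.M - m by omega]
    exact hc'
  · rw [smul_smul, ← pow_add, show S.M₀ - m - 1 + (S.M - S.M₀) = S.M - m - 1 by omega]
    exact hc

end VisiblePairHypothesesM

/-! ## Product-form pair data are visible pair data -/

namespace PairHypothesesM

variable {V₁ V₂ : Type*} [AddCommGroup V₁] [AddCommGroup V₂] {Pl : Type*}
variable (S : PairHypothesesM V₁ V₂ Pl)

/-- **Pair data with the product-form Čebotarev are visible pair data** (`H = V₁ × V₂`,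
`rK₁ = inl`, `rK₂ = inr`, `LocK ℓ = Loc₁ λ × Loc₂ λ`): the visible form GENERALISES the pair form.
[cite: McCallumLMS1991, §3, §5] [cite: GrossLMS1991, Prop. 9.1] -/
def toVisiblePair : VisiblePairHypothesesM V₁ V₂ Pl (V₁ × V₂) where
  p := S.p
  hp := S.hp
  M := S.M
  torsion₁ := S.torsion₁
  torsion₂ := S.torsion₂
  Sel₁ := S.Sel₁
  Sel₂ := S.Sel₂
  Loc₁ := S.Loc₁
  Loc₂ := S.Loc₂
  mem_sel_iff₁ := S.mem_sel_iff₁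
  mem_sel_iff₂ := S.mem_sel_iff₂
  Kol := S.Kol
  prime_of_kol := S.prime_of_kol
  pl := S.pl
  Dv := S.Dv
  dv_iff := S.dv_iff
  dv_mul := S.dv_mul
  A₁ := S.A₁
  A₂ := S.A₂
  x := S.x
  x_mem := S.x_mem
  x_ord := S.x_ord
  M₀ := S.M₀
  c₁ := S.c₁
  c₂ := S.c₂
  c_one := S.c_one
  c_mem_loc₁ := S.c_mem_loc₁
  c_mem_loc₂ := S.c_mem_loc₂
  c_mem_loc_iff₁₂ := S.c_mem_loc_iff₁₂
  c_mem_loc_iff₂₁ := S.c_mem_loc_iff₂₁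
  duality₁ := S.duality₁
  duality₂ := S.duality₂
  rK₁ := AddMonoidHom.inl V₁ V₂
  rK₂ := AddMonoidHom.inr V₁ V₂
  LocK ℓ := (S.Loc₁ (S.pl ℓ)).prod (S.Loc₂ (S.pl ℓ))
  mem_loc₁_pl_iff ℓ _ u := by simp [AddSubgroup.mem_prod]
  mem_loc₂_pl_iff ℓ _ w := by simp [AddSubgroup.mem_prod]
  sel_visible s₁ _ s₂ _ h := by simpa [Prod.ext_iff] using h
  cebotarev r cs Nv hne hN hpure hind b :=
    S.cebotarev r cs Nv hne hN hpure (fun a ha ↦ hind a (by simpa [Prod.ext_iff] using ha)) b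

-- Cross-check (an `example`): the pair form's Claim A re-derived through the visible form.
example {s : V₂} (hs : s ∈ S.Sel₂) : ((S.p : ℤ) ^ S.M₀) • s = 0 :=
  S.toVisiblePair.pow_zsmul_sel₂_eq_zero_and_sel₁_le.1 s hs

end PairHypothesesM

end KolyvaginDescent

end Literature.NumberTheory.EllipticCurves

end
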